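import Literature.Analysis.FluidPDE.CheskidovShvydkoyBlockEnergy
import Literature.Analysis.FluidPDE.CheskidovShvydkoyDyadicEnergy
import Literature.Analysis.FluidPDE.SupGronwall
import HarnessLib

/-!
# The `H¹` a-priori estimate of Cheskidov–Shvydkoy's Lemma 3.2 along a smooth slab solution

Analysis/FluidPDE support file (serves the discharge of
`Literature.Analysis.FluidPDE.cheskidov_shvydkoy`, ns.S31). Lemma 3.2 of Cheskidov–Shvydkoy
(Arch. Ration. Mech. Anal. 195 (2010); arXiv:0708.3067, pp. 5–6): if a Leray–Hopf solution satisfies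
`‖Δ̇_q u(t)‖_∞ < c ν λ_q` for `q ≥ Q` on an interval of regularity, then the Sobolev norm stays bounded
up to the end of the interval ("Gronwall's Lemma implies that `u(t)` is bounded in `H^{(1+ε)/2}` up to
`t = β`"), so the interval continues. This file **proves** the `H¹` version of the a-priori estimate
for a *smooth slab solution* (`IsSmoothSlabSolution`, `CheskidovShvydkoyBlockEnergy.lean`), i.e.
on a compact sub-slab of an interval of regularity, where every manipulation is classical:

* `IsRegularSlab.intervalIntegrable_inner_blockFn`: the kinematic pairing is integrable in time;
  `IsSmoothSlabSolution.weighted_blockEnergy_eq`: the block balances (8) weighted by `4^j` and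
  summed over `|j| ≤ L`;
* `sum_Icc_enorm_nonlinear_le`, `weighted_integrand_le`: the weighted nonlinear terms are bounded
  by the paraproduct estimate (`CheskidovShvydkoyNonlinear`, `ParaproductSums`); after Young the
  dissipation produced is `α D ≤ (ν/2) X_L + α 4^{-L} T_c` (uniform tails,
  `CheskidovShvydkoyDyadicEnergy`), absorbed by `-ν X_L` as soon as `2 d α ≤ ν` — this is where the
  smallness `κ = c ν` of the high blocks enters; what remains is `K_c F + G_c`;
* `IsSmoothSlabSolution.dyadicF_two_point`: letting `L → ∞`, the two-point inequality
  `f(t) ≤ f(s) + (t-s)(2 G_c + 2 K_c sup_{[s,t]} f)` for `f = F(v(·)).toReal` (no time derivative of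
  the infinite sum is ever taken);
* `IsSmoothSlabSolution.dyadicF_le_exp`, `gradSq_le_exp`: the Gronwall conclusion
  (`SupGronwall.lean`) and its translation to `∑_i ‖∂_i v(t)‖²₂` through the square function:
  the enstrophy at time `t` is bounded in terms of the enstrophy at time `t₁`, the energy `E₀`, the
  Bernstein scale `J`, `ν` and the Littlewood–Paley constants (`LPBounds`) — independently of the
  `H¹` norm on the slab, which is what feeds Leray's continuation criterion.

The constants are explicit (`LPBounds.cM`, `cAlpha`, `cTail`, `cK`, `cG`).

## References

* A. Cheskidov, R. Shvydkoy, Arch. Ration. Mech. Anal. 195 (2010) 159–169 = arXiv:0708.3067,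
  Lemma 3.2 and its proof, pp. 5–6. [CheskidovShvydkoy2010]
* W. S. Ożański, B. C. Pooley, in: PDE in Fluid Mechanics, LMS LN 452, CUP 2018, Cor. 6.16,
  Thm. 6.17, Cor. 6.24 (Leray's `H¹` continuation). [OzanskiPooley2018]
-/

noncomputable section

open MeasureTheory Filter Topology Function Set
open Literature.Analysis.FunctionSpaces
open scoped ENNReal NNReal RealInnerProductSpace

namespace Literature.Analysis.FluidPDE

section SlabIntegrability

variable {E : Type*} [NormedAddCommGroup E] [InnerProductSpace ℝ E] [FiniteDimensional ℝ E]
  [MeasurableSpace E] [BorelSpace E]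
variable {E' : Type*} [NormedAddCommGroup E'] [InnerProductSpace ℝ E']

/-- **The kinematic block pairing is integrable in time** on every compact sub-interval: for a
regular slab, `τ ↦ ∫ ⟪Δ̇_j v(τ), Δ̇_j ∂ₜv(τ)⟫` is interval integrable on `[s, t] ⊆ [t₁, t₂]` (the
pairing is jointly continuous and bounded in `L¹(E)` uniformly in time; Fubini). [folklore] -/
theorem IsRegularSlab.intervalIntegrable_inner_blockFn {t₁ t₂ : ℝ} {v : ℝ → E → E'}
    (h : IsRegularSlab t₁ t₂ v) (j : ℤ) {s t : ℝ} (hs : t₁ ≤ s) (hst : s ≤ t) (ht : t ≤ t₂) :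
    IntervalIntegrable (fun τ => ∫ x, ⟪blockFn j (v τ) x, blockFn j (timeDerivWithin (Icc t₁ t₂) v τ) x⟫)
      volume s t := by
  classical
  rcases eq_or_lt_of_le hst with rfl | hst'
  · exact IntervalIntegrable.refl
  have h12 : t₁ < t₂ := lt_of_le_of_lt hs (hst'.trans_le ht)
  set w : ℝ → E → E' := fun τ => blockFn j (v τ) with hw
  set dw : ℝ → E → E' := fun τ => blockFn j (timeDerivWithin (Icc t₁ t₂) v τ) with hdw
  obtain ⟨M₀, hM₀⟩ := h.bound
  obtain ⟨M₁, hM₁⟩ := h.bound_dt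
  obtain ⟨C₀, hC₀⟩ := h.sq
  obtain ⟨C₁, hC₁⟩ := h.sq_dt
  have hsub : Icc s t ⊆ Icc t₁ t₂ := Icc_subset_Icc hs ht
  have hwc : ContinuousOn (fun z : ℝ × E => w z.1 z.2) (Icc t₁ t₂ ×ˢ univ) :=
    continuousOn_blockFn_uncurry h.smooth.continuousOn hM₀ j
  have hdwc : ContinuousOn (fun z : ℝ × E => dw z.1 z.2) (Icc t₁ t₂ ×ˢ univ) :=
    continuousOn_blockFn_uncurry (h.smooth_dt h12).continuousOn hM₁ j
  have hws : ∀ τ ∈ Icc t₁ t₂, Continuous (w τ) := fun τ hτ => by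
    have : Continuous fun x : E => (fun z : ℝ × E => w z.1 z.2) (τ, x) :=
      hwc.comp_continuous (continuous_const.prodMk continuous_id) fun x => ⟨hτ, mem_univ _⟩
    exact this
  have hdws : ∀ τ ∈ Icc t₁ t₂, Continuous (dw τ) := fun τ hτ => by
    have : Continuous fun x : E => (fun z : ℝ × E => dw z.1 z.2) (τ, x) :=
      hdwc.comp_continuous (continuous_const.prodMk continuous_id) fun x => ⟨hτ, mem_univ _⟩
    exact this
  set Kk : ℝ≥0∞ := (∫⁻ y, ‖blockKernel E j y‖ₑ) with hK
  have hKtop : Kk ≠ ∞ := (integrable_blockKernel j).2.ne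
  have hw2 : ∀ τ ∈ Icc t₁ t₂, ∫⁻ x, ‖w τ x‖ₑ ^ 2 ≤ Kk ^ 2 * C₀ := fun τ hτ =>
    lintegral_blockFn_sq_le (fun τ hτ => (h.continuous_slice hτ).aestronglyMeasurable) hC₀ j hτ
  have hdslice : ∀ τ ∈ Icc t₁ t₂, Continuous (timeDerivWithin (Icc t₁ t₂) v τ) := fun τ hτ => by
    have : Continuous fun x : E => uncurry (timeDerivWithin (Icc t₁ t₂) v) (τ, x) :=
      (h.smooth_dt h12).continuousOn.comp_continuous (continuous_const.prodMk continuous_id)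
        fun x => ⟨hτ, mem_univ _⟩
    exact this
  have hdw2 : ∀ τ ∈ Icc t₁ t₂, ∫⁻ x, ‖dw τ x‖ₑ ^ 2 ≤ Kk ^ 2 * C₁ := fun τ hτ =>
    lintegral_blockFn_sq_le (fun τ hτ => (hdslice τ hτ).aestronglyMeasurable) hC₁ j hτ
  set G : ℝ × E → ℝ := fun z => ⟪w z.1 z.2, dw z.1 z.2⟫ with hG
  have hGc : ContinuousOn G (Icc s t ×ˢ univ) :=
    ((hwc.mono (prod_mono hsub Subset.rfl)).inner (hdwc.mono (prod_mono hsub Subset.rfl)))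
  have hGslice : ∀ τ ∈ Icc s t, ∫⁻ x, ‖G (τ, x)‖ₑ ≤ (Kk ^ 2 * C₀) ^ (1 / 2 : ℝ) * (Kk ^ 2 * C₁) ^ (1 / 2 : ℝ) := by
    intro τ hτ
    refine (IsRegularSlab.lintegral_enorm_inner_le (hws τ (hsub hτ)).aestronglyMeasurable
      (hdws τ (hsub hτ)).aestronglyMeasurable).trans ?_
    gcongr
    · exact hw2 τ (hsub hτ)
    · exact hdw2 τ (hsub hτ)
  have hGint : Integrable G ((volume.restrict (Ioo s t)).prod volume) := by
    refine integrable_prod_of_continuousOn_of_lintegral hGc ?_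
    calc ∫⁻ τ in Ioo s t, ∫⁻ x, ‖G (τ, x)‖ₑ
        ≤ ∫⁻ τ in Ioo s t, (Kk ^ 2 * C₀) ^ (1 / 2 : ℝ) * (Kk ^ 2 * C₁) ^ (1 / 2 : ℝ) := by
          refine setLIntegral_mono measurable_const fun τ hτ => hGslice τ (Ioo_subset_Icc_self hτ)
      _ < ⊤ := by
          rw [setLIntegral_const, Real.volume_Ioo]
          refine ENNReal.mul_lt_top (ENNReal.mul_lt_top ?_ ?_) ENNReal.ofReal_lt_top
          · exact ENNReal.rpow_lt_top_of_nonneg (by norm_num)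
              (ENNReal.mul_ne_top (ENNReal.pow_ne_top hKtop) ENNReal.coe_ne_top)
          · exact ENNReal.rpow_lt_top_of_nonneg (by norm_num)
              (ENNReal.mul_ne_top (ENNReal.pow_ne_top hKtop) ENNReal.coe_ne_top)
  have hτint : Integrable (fun τ => ∫ x, G (τ, x)) (volume.restrict (Ioo s t)) := hGint.integral_prod_left
  rw [intervalIntegrable_iff_integrableOn_Ioo_of_le hst]
  exact hτint

end SlabIntegrability

end Literature.Analysis.FluidPDE

namespace Literature.Analysis.FluidPDE

section Weighted

variable {ι : Type*} [Fintype ι]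

/-- Real block energies are `toReal` of the squared `L²` norms. [folklore] -/
theorem integral_norm_sq_eq_toReal_eLpNorm_sq {f : (EuclideanSpace ℝ ι) → (EuclideanSpace ℝ ι)} (hf : AEStronglyMeasurable f volume) :
    ∫ x, ‖f x‖ ^ 2 = (eLpNorm f 2 volume ^ 2).toReal := by
  rw [integral_eq_lintegral_of_nonneg_ae (Eventually.of_forall fun x => by positivity)
    ((hf.norm.pow 2).congr (Eventually.of_forall fun x => by simp)), eLpNorm_two_sq_eq_lintegral]
  congr 1
  refine lintegral_congr fun x => ?_
  rw [← ofReal_norm, ENNReal.ofReal_pow (norm_nonneg _)]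

variable {t₁ t₂ ν : ℝ} {v : ℝ → (EuclideanSpace ℝ ι) → (EuclideanSpace ℝ ι)} {p : ℝ → (EuclideanSpace ℝ ι) → ℝ}

/-- The slice identity behind `blockEnergy_eq`, restated: on the slab,
`∫ ⟪Δ̇_j v, Δ̇_j ∂ₜv⟫ = -ν ∑_i ‖∂_i Δ̇_j v‖²₂ - ∫ ⟪Δ̇_j v, Δ̇_j (v·∇)v⟫`. [folklore] -/
theorem IsSmoothSlabSolution.integral_inner_blockFn_dt_eq (h : IsSmoothSlabSolution t₁ t₂ ν v p) (j : ℤ)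
    {τ : ℝ} (hτ : τ ∈ Icc t₁ t₂) :
    ∫ x, ⟪blockFn j (v τ) x, blockFn j (timeDerivWithin (Icc t₁ t₂) v τ) x⟫ =
      -ν * (∑ i, ∫ x, ‖fderiv ℝ (blockFn j (v τ)) x (stdOrthonormalBasis ℝ (EuclideanSpace ℝ ι) i)‖ ^ 2) -
        ∫ x, ⟪blockFn j (v τ) x, blockFn j (convect (v τ) (v τ)) x⟫ := by
  refine integral_inner_blockFn_ns_rhs (E := (EuclideanSpace ℝ ι)) (h.smooth_slice τ hτ) (h.ns.divFree τ hτ) (h.smooth_pressure τ hτ)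
    (ν := ν) (fun x => ?_) j
  have hm := h.ns.momentum τ hτ x
  simp only [Pi.zero_apply, add_zero] at hm
  rw [eq_sub_iff_add_eq.2 hm]
  abel

/-- The block balance integrand is interval integrable on compact sub-intervals of the slab. [folklore] -/
theorem IsSmoothSlabSolution.intervalIntegrable_rhs (h : IsSmoothSlabSolution t₁ t₂ ν v p) (j : ℤ)
    {s t : ℝ} (hs : t₁ ≤ s) (hst : s ≤ t) (ht : t ≤ t₂) :
    IntervalIntegrable (fun τ => -ν * (∑ i, ∫ x, ‖fderiv ℝ (blockFn j (v τ)) x (stdOrthonormalBasis ℝ (EuclideanSpace ℝ ι) i)‖ ^ 2) -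
        ∫ x, ⟪blockFn j (v τ) x, blockFn j (convect (v τ) (v τ)) x⟫) volume s t := by
  refine (h.regular.intervalIntegrable_inner_blockFn j hs hst ht).congr fun τ hτ => ?_
  rw [uIoc_of_le hst] at hτ
  exact h.integral_inner_blockFn_dt_eq j ⟨hs.trans hτ.1.le, hτ.2.trans ht⟩

/-- **The weighted block energy identity at level `L`**: with `W_L(τ) = ∑_{|j|≤L} 4^j ‖Δ̇_j v(τ)‖²₂`,
`W_L(t) - W_L(s) = 2 ∫ₛᵗ ∑_{|j|≤L} 4^j (-ν ∑_i ‖∂_i Δ̇_j v‖²₂ - ∫ ⟪Δ̇_j v, Δ̇_j (v·∇)v⟫) dτ`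
(Cheskidov–Shvydkoy's (8) multiplied by `λ_q²` and summed over `q`). [folklore] -/
theorem IsSmoothSlabSolution.weighted_blockEnergy_eq (h : IsSmoothSlabSolution t₁ t₂ ν v p) (L : ℕ)
    {s t : ℝ} (hs : t₁ ≤ s) (hst : s ≤ t) (ht : t ≤ t₂) :
    (∑ j ∈ Finset.Icc (-(L : ℤ)) L, (2 : ℝ) ^ (2 * j) * ∫ x, ‖blockFn j (v t) x‖ ^ 2) -
      ∑ j ∈ Finset.Icc (-(L : ℤ)) L, (2 : ℝ) ^ (2 * j) * ∫ x, ‖blockFn j (v s) x‖ ^ 2 =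
      2 * ∫ τ in s..t, ∑ j ∈ Finset.Icc (-(L : ℤ)) L, (2 : ℝ) ^ (2 * j) *
        (-ν * (∑ i, ∫ x, ‖fderiv ℝ (blockFn j (v τ)) x (stdOrthonormalBasis ℝ (EuclideanSpace ℝ ι) i)‖ ^ 2) -
          ∫ x, ⟪blockFn j (v τ) x, blockFn j (convect (v τ) (v τ)) x⟫) := by
  rw [← Finset.sum_sub_distrib, intervalIntegral.integral_finsetSum fun j _ =>
    ((h.intervalIntegrable_rhs j hs hst ht).const_mul _), Finset.mul_sum]
  refine Finset.sum_congr rfl fun j _ => ?_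
  rw [← mul_sub, h.blockEnergy_eq j hs hst ht, intervalIntegral.integral_const_mul]
  ring

end Weighted

end Literature.Analysis.FluidPDE

namespace Literature.Analysis.FluidPDE

section SliceBound

open LPBounds

variable {ι : Type*} [Fintype ι] (K : LPBounds ι)

/-- The truncated dissipation `X_L(u) = ∑_{|j|≤L} 4^j ∑_i ‖∂_i Δ̇_j u‖²₂` (in `ℝ≥0∞`). [folklore] -/
def truncDissip (L : ℕ) (u : EuclideanSpace ℝ ι → EuclideanSpace ℝ ι) : ℝ≥0∞ :=
  ∑ j ∈ Finset.Icc (-(L : ℤ)) L, (2 : ℝ≥0∞) ^ (2 * j) *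
    ∑ i, eLpNorm (fun x => fderiv ℝ (blockFn j u) x (stdOrthonormalBasis ℝ (EuclideanSpace ℝ ι) i)) 2 volume ^ 2

/-- `D_L ≤ d X_L`: the truncated dyadic dissipation against the truncated true dissipation
(finite Cauchy–Schwarz `(∑_i ‖∂_i Δ̇_j u‖₂)² ≤ d ∑_i ‖∂_i Δ̇_j u‖²₂`). [folklore] -/
theorem sum_Icc_blockGrad_sq_le_truncDissip (L : ℕ) (u : EuclideanSpace ℝ ι → EuclideanSpace ℝ ι) :
    ∑ j ∈ Finset.Icc (-(L : ℤ)) L, ((2 : ℝ≥0∞) ^ j * blockGrad u j) ^ 2 ≤ Fintype.card ι * truncDissip L u := by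
  have h2 : (2 : ℝ≥0∞) ≠ 0 := two_ne_zero
  have h2' : (2 : ℝ≥0∞) ≠ ∞ := ENNReal.ofNat_ne_top
  have hd : Fintype.card (Fin (Module.finrank ℝ (EuclideanSpace ℝ ι))) = Fintype.card ι := by
    rw [Fintype.card_fin, finrank_euclideanSpace]
  unfold truncDissip
  rw [Finset.mul_sum]
  refine Finset.sum_le_sum fun j _ => ?_
  rw [mul_pow, ← mul_assoc, mul_comm (Fintype.card ι : ℝ≥0∞), mul_assoc, show ((2 : ℝ≥0∞) ^ j) ^ 2 = 2 ^ (2 * j) by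
    rw [two_mul, ENNReal.zpow_add h2 h2', sq]]
  gcongr
  unfold blockGrad
  have := ennreal_sq_sum_le_card_mul_sum_sq (Finset.univ : Finset (Fin (Module.finrank ℝ (EuclideanSpace ℝ ι))))
    (fun i => eLpNorm (fun x => fderiv ℝ (blockFn j u) x (stdOrthonormalBasis ℝ (EuclideanSpace ℝ ι) i)) 2 volume)
  rwa [Finset.card_univ, hd] at this

/-! ### The constants of the estimate -/

/-- The low-frequency Bernstein bound `M = C_∞ E₀ 2^{(J-1)d/2} ∑_n 2^{-nd/2}`. [folklore] -/
def LPBounds.cM (J : ℤ) (E₀ : ℝ≥0∞) : ℝ≥0∞ :=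
  K.Cinf * E₀ * (2 : ℝ≥0∞) ^ (((J - 1 : ℤ) : ℝ) * Fintype.card ι * 2⁻¹) * geomDim ι

/-- The coefficient of the dissipation produced by the nonlinear terms after Young:
`α = 20 C₂ M ε₁ + 2570 C₂ κ C_r + 5 C₂ (C₂ E₀) M 2^{J+4} ε₂`. [folklore] -/
def LPBounds.cAlpha (J : ℤ) (κ E₀ ε₁ ε₂ : ℝ≥0∞) : ℝ≥0∞ :=
  20 * K.C₂ * K.cM J E₀ * ε₁ + 2570 * K.C₂ * κ * K.Cr + 5 * K.C₂ * (K.C₂ * E₀) * K.cM J E₀ * 2 ^ (J + 4) * ε₂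

/-- The tail constant `T_c = (C_r² C₂ S₃)² + (d C_b C₂ E₀)²`. [folklore] -/
def LPBounds.cTail (E₀ S₃ : ℝ≥0∞) : ℝ≥0∞ :=
  ((K.Cr : ℝ≥0∞) ^ 2 * K.C₂ * S₃) ^ 2 + (Fintype.card ι * (K.Cb * (K.C₂ * E₀))) ^ 2

/-- The Gronwall rate `K_c = 20 C₂ M ε₁⁻¹`. [folklore] -/
def LPBounds.cK (J : ℤ) (E₀ ε₁ : ℝ≥0∞) : ℝ≥0∞ := 20 * K.C₂ * K.cM J E₀ * ε₁⁻¹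

/-- The Gronwall source `G_c = 5 C₂ (C₂ E₀) M 2^{J+4} ε₂⁻¹`. [folklore] -/
def LPBounds.cG (J : ℤ) (E₀ ε₂ : ℝ≥0∞) : ℝ≥0∞ := 5 * K.C₂ * (K.C₂ * E₀) * K.cM J E₀ * 2 ^ (J + 4) * ε₂⁻¹

/-- `M < ∞` for finite energy in positive dimension. [folklore] -/
theorem LPBounds.cM_ne_top [Nonempty ι] (J : ℤ) {E₀ : ℝ≥0∞} (hE₀ : E₀ ≠ ∞) : K.cM J E₀ ≠ ∞ := by
  unfold LPBounds.cM
  exact ENNReal.mul_ne_top (ENNReal.mul_ne_top (ENNReal.mul_ne_top ENNReal.coe_ne_top hE₀)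
    (ENNReal.rpow_ne_top_of_ne_zero two_ne_zero ENNReal.ofNat_ne_top)) geomDim_lt_top.ne

/-- **The weighted nonlinear terms of the truncated balance are absorbed and of Gronwall type.**
For a divergence-free smooth `L²` field `u` with `‖Δ̇_l u‖_∞ ≤ κ 2^l` (`l ≥ J`), `‖u‖₂ ≤ E₀`,
`T₃(u) ≤ S₃`, Young parameters `ε₁, ε₂` and the smallness condition `2 d α ≤ ν`:
`∑_{|j|≤L} 4^j ‖∫⟪Δ̇_j u, Δ̇_j (u·∇)u⟫‖ ≤ (ν/2) X_L(u) + α 4^{-L} T_c + K_c F(u) + G_c`.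
[cite: CheskidovShvydkoy2010, Lemma 3.2 (proof, pp. 5–6)] -/
theorem sum_Icc_enorm_nonlinear_le {u : EuclideanSpace ℝ ι → EuclideanSpace ℝ ι} (hu : IsSmoothL2Field u)
    (hdiv : VectorCalculus.IsDivFree u) {J : ℤ} {κ E₀ S₃ ε₁ ε₂ : ℝ≥0∞} {ν : ℝ}
    (hs : ∀ l, J ≤ l → blockSup u l ≤ κ * 2 ^ l) (hE : eLpNorm u 2 volume ≤ E₀) (hS₃ : thirdSum u ≤ S₃)
    (hε₁ : ε₁ ≠ 0) (hε₁' : ε₁ ≠ ∞) (hε₂ : ε₂ ≠ 0) (hε₂' : ε₂ ≠ ∞)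
    (hsmall : 2 * Fintype.card ι * K.cAlpha J κ E₀ ε₁ ε₂ ≤ ENNReal.ofReal ν) (L : ℕ) :
    ∑ j ∈ Finset.Icc (-(L : ℤ)) L, (2 : ℝ≥0∞) ^ (2 * j) * ‖∫ x, ⟪blockFn j u x, blockFn j (convect u u) x⟫‖ₑ ≤
      ENNReal.ofReal ν / 2 * truncDissip L u +
      (K.cAlpha J κ E₀ ε₁ ε₂ * ((4⁻¹ : ℝ≥0∞) ^ L * K.cTail E₀ S₃) + K.cK J E₀ ε₁ * dyadicF u + K.cG J E₀ ε₂) := by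
  -- names for the constants
  set d : ℝ≥0∞ := (Fintype.card ι : ℝ≥0∞) with hd
  set M : ℝ≥0∞ := K.cM J E₀ with hM
  set A₀ : ℝ≥0∞ := K.C₂ * E₀ with hA₀
  set c₃ : ℝ≥0∞ := 5 * K.C₂ * A₀ * M * 2 ^ (J + 4) with hc₃
  set α : ℝ≥0∞ := K.cAlpha J κ E₀ ε₁ ε₂ with hα
  have hα' : α = 20 * K.C₂ * M * ε₁ + 2570 * K.C₂ * κ * K.Cr + c₃ * ε₂ := by rw [hα, cAlpha, hc₃, hA₀, hM]
  set Tc : ℝ≥0∞ := K.cTail E₀ S₃ with hTc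
  set a : ℤ → ℝ≥0∞ := blockL2 u
  set s : ℤ → ℝ≥0∞ := blockSup u
  set g : ℤ → ℝ≥0∞ := blockGrad u
  set F := dyadicF u
  set D := dyadicD u
  -- Step 1: the nonlinear terms against the paraproduct shapes, summed with weights
  have hC₂ : ∀ j (f : EuclideanSpace ℝ ι → EuclideanSpace ℝ ι), MemLp f 2 volume →
      eLpNorm (blockFn j f) 2 volume ≤ K.C₂ * eLpNorm f 2 volume := K.two_le
  have hN : ∀ j, ‖∫ x, ⟪blockFn j u x, blockFn j (convect u u) x⟫‖ₑ ≤
      g j * K.C₂ * (2 * ∑ m ∈ Finset.Icc (-2 : ℤ) 2, a (j + m) * paraT s (j + m) + paraQ2 s a j) :=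
    fun j => enorm_integral_inner_blockFn_convect_le hu hdiv (K.tendsto u hu.memLp_two) j (hC₂ j)
  have hstep1 : ∑ j ∈ Finset.Icc (-(L : ℤ)) L, (2 : ℝ≥0∞) ^ (2 * j) * ‖∫ x, ⟪blockFn j u x, blockFn j (convect u u) x⟫‖ₑ ≤
      K.C₂ * ∑' j, (2 : ℝ≥0∞) ^ (2 * j) * g j * (2 * ∑ m ∈ Finset.Icc (-2 : ℤ) 2, a (j + m) * paraT s (j + m) + paraQ2 s a j) := by
    calc ∑ j ∈ Finset.Icc (-(L : ℤ)) L, (2 : ℝ≥0∞) ^ (2 * j) * ‖∫ x, ⟪blockFn j u x, blockFn j (convect u u) x⟫‖ₑ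
        ≤ ∑ j ∈ Finset.Icc (-(L : ℤ)) L, (2 : ℝ≥0∞) ^ (2 * j) *
            (g j * K.C₂ * (2 * ∑ m ∈ Finset.Icc (-2 : ℤ) 2, a (j + m) * paraT s (j + m) + paraQ2 s a j)) := by
          gcongr with j; exact hN j
      _ ≤ ∑' j, (2 : ℝ≥0∞) ^ (2 * j) *
            (g j * K.C₂ * (2 * ∑ m ∈ Finset.Icc (-2 : ℤ) 2, a (j + m) * paraT s (j + m) + paraQ2 s a j)) :=
          ENNReal.sum_le_tsum _
      _ = K.C₂ * ∑' j, (2 : ℝ≥0∞) ^ (2 * j) * g j * (2 * ∑ m ∈ Finset.Icc (-2 : ℤ) 2, a (j + m) * paraT s (j + m) + paraQ2 s a j) := by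
          rw [← ENNReal.tsum_mul_left]; exact tsum_congr fun j => by ring
  -- Step 2: the weighted paraproduct sum
  have hMle : ∑' n : ℕ, s (J - 1 - n) ≤ M := by
    refine (K.tsum_blockSup_low_le hu.memLp_two J).trans ?_
    rw [hM, cM]; gcongr
  have hrev : ∀ l, (2 : ℝ≥0∞) ^ l * a l ≤ K.Cr * g l := fun l => K.two_zpow_mul_blockL2_le hu l
  have ha : ∀ l, a l ≤ A₀ := fun l => (K.blockL2_le hu.memLp_two l).trans (by rw [hA₀]; gcongr)
  have hstep2 := paraproduct_weighted_sum_le a s g J κ M K.Cr A₀ hs hMle hrev ha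
  -- Step 3: Young and the tail bound
  have hD : D ≤ d * truncDissip L u + (4⁻¹ : ℝ≥0∞) ^ L * Tc := by
    refine (K.dyadicD_le_sum_Icc_add hu L).trans ?_
    refine add_le_add (sum_Icc_blockGrad_sq_le_truncDissip L u) ?_
    rw [hTc, cTail]; gcongr
  have hY1 : 40 * (M * (D ^ (1 / 2 : ℝ) * F ^ (1 / 2 : ℝ))) ≤ 20 * M * (ε₁ * D + ε₁⁻¹ * F) := by
    calc 40 * (M * (D ^ (1 / 2 : ℝ) * F ^ (1 / 2 : ℝ))) = 20 * M * (2 * (D ^ (1 / 2 : ℝ) * F ^ (1 / 2 : ℝ))) := by ring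
      _ ≤ 20 * M * (ε₁ * D + ε₁⁻¹ * F) := by gcongr; exact two_mul_sqrt_mul_sqrt_le D F hε₁ hε₁'
  have hY2 : 5 * (A₀ * (M * (2 ^ (J + 4) * D ^ (1 / 2 : ℝ)))) ≤ 5 * A₀ * M * 2 ^ (J + 4) * (ε₂ * D + ε₂⁻¹) := by
    have h1 : D ^ (1 / 2 : ℝ) ≤ ε₂ * D + ε₂⁻¹ * 1 := by
      have := two_mul_sqrt_mul_sqrt_le D 1 hε₂ hε₂'
      rw [ENNReal.one_rpow, mul_one] at this
      exact le_trans (by rw [two_mul]; exact le_self_add) this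
    rw [mul_one] at h1
    calc 5 * (A₀ * (M * (2 ^ (J + 4) * D ^ (1 / 2 : ℝ)))) = (5 * A₀ * M * 2 ^ (J + 4)) * D ^ (1 / 2 : ℝ) := by ring
      _ ≤ (5 * A₀ * M * 2 ^ (J + 4)) * (ε₂ * D + ε₂⁻¹) := by gcongr
  have hαd : α * d ≤ ENNReal.ofReal ν / 2 := by
    rw [ENNReal.le_div_iff_mul_le (Or.inl two_ne_zero) (Or.inl ENNReal.ofNat_ne_top)]
    calc α * d * 2 = 2 * d * α := by ring
      _ ≤ ENNReal.ofReal ν := by rw [hα, hd]; exact hsmall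
  have hKc : K.cK J E₀ ε₁ = 20 * K.C₂ * M * ε₁⁻¹ := by rw [cK, hM]
  have hGc : K.cG J E₀ ε₂ = c₃ * ε₂⁻¹ := by rw [cG, hc₃, hA₀, hM]
  -- Step 4: combine
  calc ∑ j ∈ Finset.Icc (-(L : ℤ)) L, (2 : ℝ≥0∞) ^ (2 * j) * ‖∫ x, ⟪blockFn j u x, blockFn j (convect u u) x⟫‖ₑ
      ≤ K.C₂ * (40 * (M * (D ^ (1 / 2 : ℝ) * F ^ (1 / 2 : ℝ))) + 2570 * (κ * (K.Cr * D)) +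
          5 * (A₀ * (M * (2 ^ (J + 4) * D ^ (1 / 2 : ℝ))))) := hstep1.trans (mul_le_mul_right hstep2 _)
    _ ≤ K.C₂ * (20 * M * (ε₁ * D + ε₁⁻¹ * F) + 2570 * (κ * (K.Cr * D)) +
          5 * A₀ * M * 2 ^ (J + 4) * (ε₂ * D + ε₂⁻¹)) := by gcongr
    _ = α * D + (20 * K.C₂ * M * ε₁⁻¹ * F + c₃ * ε₂⁻¹) := by rw [hα', hc₃]; ring
    _ ≤ α * (d * truncDissip L u + (4⁻¹ : ℝ≥0∞) ^ L * Tc) + (20 * K.C₂ * M * ε₁⁻¹ * F + c₃ * ε₂⁻¹) := by gcongr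
    _ = α * d * truncDissip L u + (α * ((4⁻¹ : ℝ≥0∞) ^ L * Tc) + 20 * K.C₂ * M * ε₁⁻¹ * F + c₃ * ε₂⁻¹) := by ring
    _ ≤ ENNReal.ofReal ν / 2 * truncDissip L u + (α * ((4⁻¹ : ℝ≥0∞) ^ L * Tc) + 20 * K.C₂ * M * ε₁⁻¹ * F + c₃ * ε₂⁻¹) := by
        gcongr
    _ = _ := by rw [hKc, hGc]

/-! ### From `ℝ≥0∞` to the real balance -/

/-- `(2^k : ℝ≥0∞).toReal = 2^k`. [folklore] -/
theorem toReal_two_zpow (k : ℤ) : ((2 : ℝ≥0∞) ^ k).toReal = (2 : ℝ) ^ k := by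
  rw [← ofReal_two_zpow, ENNReal.toReal_ofReal (zpow_nonneg (by norm_num) _)]

/-- The real truncated dissipation is `toReal` of `truncDissip`. [folklore] -/
theorem sum_Icc_dissip_eq_toReal {u : EuclideanSpace ℝ ι → EuclideanSpace ℝ ι} (hu : IsSmoothL2Field u) (L : ℕ) :
    ∑ j ∈ Finset.Icc (-(L : ℤ)) L, (2 : ℝ) ^ (2 * j) *
        ∑ i, ∫ x, ‖fderiv ℝ (blockFn j u) x (stdOrthonormalBasis ℝ (EuclideanSpace ℝ ι) i)‖ ^ 2 =
      (truncDissip L u).toReal := by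
  have hfin : ∀ j i, eLpNorm (fun x => fderiv ℝ (blockFn j u) x (stdOrthonormalBasis ℝ (EuclideanSpace ℝ ι) i)) 2 volume ^ 2 ≠ ∞ :=
    fun j i => ENNReal.pow_ne_top ((hu.blockFn j).memLp_fderiv_apply _).eLpNorm_ne_top
  unfold truncDissip
  rw [ENNReal.toReal_sum fun j _ => ENNReal.mul_ne_top (two_zpow_ne_top _) (ENNReal.sum_ne_top.2 fun i _ => hfin j i)]
  refine Finset.sum_congr rfl fun j _ => ?_
  rw [ENNReal.toReal_mul, toReal_two_zpow, ENNReal.toReal_sum fun i _ => hfin j i]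
  congr 1
  refine Finset.sum_congr rfl fun i _ => ?_
  exact integral_norm_sq_eq_toReal_eLpNorm_sq (((hu.blockFn j).memLp_fderiv_apply _).1)

/-- `truncDissip` is finite for smooth `L²` fields. [folklore] -/
theorem truncDissip_ne_top {u : EuclideanSpace ℝ ι → EuclideanSpace ℝ ι} (hu : IsSmoothL2Field u) (L : ℕ) :
    truncDissip L u ≠ ∞ := by
  unfold truncDissip
  refine ENNReal.sum_ne_top.2 fun j _ => ENNReal.mul_ne_top (two_zpow_ne_top _) (ENNReal.sum_ne_top.2 fun i _ => ?_)
  exact ENNReal.pow_ne_top ((hu.blockFn j).memLp_fderiv_apply _).eLpNorm_ne_top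

/-- The real weighted nonlinear terms are dominated by `toReal` of the weighted `enorm`s. [folklore] -/
theorem sum_Icc_neg_nonlinear_le_toReal (u : EuclideanSpace ℝ ι → EuclideanSpace ℝ ι) (L : ℕ)
    (hfin : ∑ j ∈ Finset.Icc (-(L : ℤ)) L, (2 : ℝ≥0∞) ^ (2 * j) *
      ‖∫ x, ⟪blockFn j u x, blockFn j (convect u u) x⟫‖ₑ ≠ ∞) :
    ∑ j ∈ Finset.Icc (-(L : ℤ)) L, (2 : ℝ) ^ (2 * j) * (-∫ x, ⟪blockFn j u x, blockFn j (convect u u) x⟫) ≤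
      (∑ j ∈ Finset.Icc (-(L : ℤ)) L, (2 : ℝ≥0∞) ^ (2 * j) *
        ‖∫ x, ⟪blockFn j u x, blockFn j (convect u u) x⟫‖ₑ).toReal := by
  rw [ENNReal.toReal_sum fun j hj => (ENNReal.lt_top_of_sum_ne_top hfin hj).ne]
  refine Finset.sum_le_sum fun j _ => ?_
  rw [ENNReal.toReal_mul, toReal_two_zpow, toReal_enorm]
  exact mul_le_mul_of_nonneg_left ((neg_le_abs _).trans (le_of_eq (Real.norm_eq_abs _).symm))
    (zpow_nonneg (by norm_num) _)

/-- Finiteness of the constants for finite data. [folklore] -/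
theorem LPBounds.cAlpha_ne_top [Nonempty ι] (J : ℤ) (κ E₀ ε₁ ε₂ : ℝ≥0) :
    K.cAlpha J κ E₀ ε₁ ε₂ ≠ ∞ := by
  have hM := K.cM_ne_top J (E₀ := E₀) ENNReal.coe_ne_top
  unfold LPBounds.cAlpha
  refine ENNReal.add_ne_top.2 ⟨ENNReal.add_ne_top.2 ⟨?_, ?_⟩, ?_⟩
  · exact ENNReal.mul_ne_top (ENNReal.mul_ne_top (ENNReal.mul_ne_top (by norm_num) ENNReal.coe_ne_top) hM) ENNReal.coe_ne_top
  · exact ENNReal.mul_ne_top (ENNReal.mul_ne_top (ENNReal.mul_ne_top (by norm_num) ENNReal.coe_ne_top) ENNReal.coe_ne_top) ENNReal.coe_ne_top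
  · refine ENNReal.mul_ne_top (ENNReal.mul_ne_top (ENNReal.mul_ne_top (ENNReal.mul_ne_top (ENNReal.mul_ne_top (by norm_num)
      ENNReal.coe_ne_top) (ENNReal.mul_ne_top ENNReal.coe_ne_top ENNReal.coe_ne_top)) hM) (two_zpow_ne_top _)) ENNReal.coe_ne_top

/-- Finiteness of the tail constant. [folklore] -/
theorem LPBounds.cTail_ne_top (E₀ S₃ : ℝ≥0) : K.cTail E₀ S₃ ≠ ∞ := by
  unfold LPBounds.cTail
  refine ENNReal.add_ne_top.2 ⟨ENNReal.pow_ne_top ?_, ENNReal.pow_ne_top ?_⟩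
  · exact ENNReal.mul_ne_top (ENNReal.mul_ne_top (ENNReal.pow_ne_top ENNReal.coe_ne_top) ENNReal.coe_ne_top) ENNReal.coe_ne_top
  · exact ENNReal.mul_ne_top (ENNReal.natCast_ne_top _) (ENNReal.mul_ne_top ENNReal.coe_ne_top
      (ENNReal.mul_ne_top ENNReal.coe_ne_top ENNReal.coe_ne_top))

/-- Finiteness of the Gronwall rate. [folklore] -/
theorem LPBounds.cK_ne_top [Nonempty ι] (J : ℤ) (E₀ : ℝ≥0) {ε₁ : ℝ≥0} (hε₁ : ε₁ ≠ 0) : K.cK J E₀ ε₁ ≠ ∞ := by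
  unfold LPBounds.cK
  exact ENNReal.mul_ne_top (ENNReal.mul_ne_top (ENNReal.mul_ne_top (by norm_num) ENNReal.coe_ne_top)
    (K.cM_ne_top J ENNReal.coe_ne_top)) (ENNReal.inv_ne_top.2 (by exact_mod_cast hε₁))

/-- Finiteness of the Gronwall source. [folklore] -/
theorem LPBounds.cG_ne_top [Nonempty ι] (J : ℤ) (E₀ : ℝ≥0) {ε₂ : ℝ≥0} (hε₂ : ε₂ ≠ 0) : K.cG J E₀ ε₂ ≠ ∞ := by
  unfold LPBounds.cG
  exact ENNReal.mul_ne_top (ENNReal.mul_ne_top (ENNReal.mul_ne_top (ENNReal.mul_ne_top (ENNReal.mul_ne_top (by norm_num)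
    ENNReal.coe_ne_top) (ENNReal.mul_ne_top ENNReal.coe_ne_top ENNReal.coe_ne_top)) (K.cM_ne_top J ENNReal.coe_ne_top))
    (two_zpow_ne_top _)) (ENNReal.inv_ne_top.2 (by exact_mod_cast hε₂))

/-- **The pointwise bound on the weighted balance integrand** (finite data, `ν ≥ 0`): with the
constants `α, T_c, K_c, G_c` of this file and the smallness `2 d α ≤ ν`,
`∑_{|j|≤L} 4^j (-ν ∑_i ‖∂_i Δ̇_j u‖²₂ - ∫⟪Δ̇_j u, Δ̇_j (u·∇)u⟫) ≤ (α 4^{-L} T_c + G_c).toReal + K_c.toReal · F(u).toReal`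
— the dissipation absorbs the `(ν/2) X_L` produced by the nonlinear terms. [folklore] -/
theorem weighted_integrand_le [Nonempty ι] {u : EuclideanSpace ℝ ι → EuclideanSpace ℝ ι} (hu : IsSmoothL2Field u)
    (hdiv : VectorCalculus.IsDivFree u) {J : ℤ} {κ E₀ S₃ ε₁ ε₂ : ℝ≥0} {ν : ℝ} (hν : 0 ≤ ν)
    (hs : ∀ l, J ≤ l → blockSup u l ≤ κ * 2 ^ l) (hE : eLpNorm u 2 volume ≤ E₀) (hS₃ : thirdSum u ≤ S₃)
    (hε₁ : ε₁ ≠ 0) (hε₂ : ε₂ ≠ 0)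
    (hsmall : 2 * Fintype.card ι * K.cAlpha J κ E₀ ε₁ ε₂ ≤ ENNReal.ofReal ν) (hF : dyadicF u ≠ ∞) (L : ℕ) :
    ∑ j ∈ Finset.Icc (-(L : ℤ)) L, (2 : ℝ) ^ (2 * j) *
        (-ν * (∑ i, ∫ x, ‖fderiv ℝ (blockFn j u) x (stdOrthonormalBasis ℝ (EuclideanSpace ℝ ι) i)‖ ^ 2) -
          ∫ x, ⟪blockFn j u x, blockFn j (convect u u) x⟫) ≤
      (K.cAlpha J κ E₀ ε₁ ε₂ * ((4⁻¹ : ℝ≥0∞) ^ L * K.cTail E₀ S₃) + K.cG J E₀ ε₂).toReal +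
        (K.cK J E₀ ε₁).toReal * (dyadicF u).toReal := by
  set B := K.cAlpha J κ E₀ ε₁ ε₂ * ((4⁻¹ : ℝ≥0∞) ^ L * K.cTail E₀ S₃) with hB
  set Gc := K.cG J E₀ ε₂ with hGc
  set Kc := K.cK J E₀ ε₁ with hKc
  set X := truncDissip L u with hX
  set Ye := ∑ j ∈ Finset.Icc (-(L : ℤ)) L, (2 : ℝ≥0∞) ^ (2 * j) * ‖∫ x, ⟪blockFn j u x, blockFn j (convect u u) x⟫‖ₑ with hYe
  have hε₁' : (ε₁ : ℝ≥0∞) ≠ 0 := by exact_mod_cast hε₁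
  have hε₂' : (ε₂ : ℝ≥0∞) ≠ 0 := by exact_mod_cast hε₂
  have hmain : Ye ≤ ENNReal.ofReal ν / 2 * X + (B + Kc * dyadicF u + Gc) :=
    sum_Icc_enorm_nonlinear_le K hu hdiv hs hE hS₃ hε₁' ENNReal.coe_ne_top hε₂' ENNReal.coe_ne_top hsmall L
  -- finiteness
  have hXtop : X ≠ ∞ := truncDissip_ne_top hu L
  have hBtop : B ≠ ∞ := ENNReal.mul_ne_top (K.cAlpha_ne_top J κ E₀ ε₁ ε₂)
    (ENNReal.mul_ne_top (ENNReal.pow_ne_top (ENNReal.inv_ne_top.2 (by norm_num))) (K.cTail_ne_top E₀ S₃))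
  have hKtop : Kc ≠ ∞ := K.cK_ne_top J E₀ hε₁
  have hGtop : Gc ≠ ∞ := K.cG_ne_top J E₀ hε₂
  have hYtop : Ye ≠ ∞ :=
    ENNReal.sum_ne_top.2 fun j _ => ENNReal.mul_ne_top (two_zpow_ne_top _) enorm_ne_top
  have hνX : ENNReal.ofReal ν / 2 * X ≠ ∞ :=
    ENNReal.mul_ne_top (ENNReal.div_ne_top ENNReal.ofReal_ne_top two_ne_zero) hXtop
  -- to the reals
  have hsplit : ∑ j ∈ Finset.Icc (-(L : ℤ)) L, (2 : ℝ) ^ (2 * j) *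
        (-ν * (∑ i, ∫ x, ‖fderiv ℝ (blockFn j u) x (stdOrthonormalBasis ℝ (EuclideanSpace ℝ ι) i)‖ ^ 2) -
          ∫ x, ⟪blockFn j u x, blockFn j (convect u u) x⟫) =
      -ν * X.toReal + ∑ j ∈ Finset.Icc (-(L : ℤ)) L, (2 : ℝ) ^ (2 * j) * (-∫ x, ⟪blockFn j u x, blockFn j (convect u u) x⟫) := by
    rw [hX, ← sum_Icc_dissip_eq_toReal hu L, Finset.mul_sum, ← Finset.sum_add_distrib]
    exact Finset.sum_congr rfl fun j _ => by ring
  have hYreal : ∑ j ∈ Finset.Icc (-(L : ℤ)) L, (2 : ℝ) ^ (2 * j) * (-∫ x, ⟪blockFn j u x, blockFn j (convect u u) x⟫) ≤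
      ν / 2 * X.toReal + (B.toReal + Kc.toReal * (dyadicF u).toReal + Gc.toReal) := by
    refine (sum_Icc_neg_nonlinear_le_toReal u L hYtop).trans ?_
    have := ENNReal.toReal_mono (ENNReal.add_ne_top.2 ⟨hνX, ENNReal.add_ne_top.2
      ⟨ENNReal.add_ne_top.2 ⟨hBtop, ENNReal.mul_ne_top hKtop hF⟩, hGtop⟩⟩) hmain
    rw [ENNReal.toReal_add hνX (ENNReal.add_ne_top.2 ⟨ENNReal.add_ne_top.2 ⟨hBtop, ENNReal.mul_ne_top hKtop hF⟩, hGtop⟩),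
      ENNReal.toReal_add (ENNReal.add_ne_top.2 ⟨hBtop, ENNReal.mul_ne_top hKtop hF⟩) hGtop,
      ENNReal.toReal_add hBtop (ENNReal.mul_ne_top hKtop hF), ENNReal.toReal_mul (a := Kc), ENNReal.toReal_mul,
      ENNReal.toReal_div, ENNReal.toReal_ofReal hν, ENNReal.toReal_ofNat] at this
    convert this using 2
  rw [hsplit, ENNReal.toReal_add hBtop hGtop]
  have hX0 : 0 ≤ X.toReal := ENNReal.toReal_nonneg
  nlinarith [mul_nonneg hν hX0]

end SliceBound

end Literature.Analysis.FluidPDE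

namespace Literature.Analysis.FluidPDE

section Slab

open LPBounds

variable {ι : Type*} [Fintype ι] [Nonempty ι] (K : LPBounds ι)
variable {t₁ t₂ ν : ℝ} {v : ℝ → EuclideanSpace ℝ ι → EuclideanSpace ℝ ι} {p : ℝ → EuclideanSpace ℝ ι → ℝ}

omit [Nonempty ι] in
/-- The real truncated dyadic energy is `toReal` of the truncated `ℝ≥0∞` sum. [folklore] -/
theorem sum_Icc_energy_eq_toReal {u : EuclideanSpace ℝ ι → EuclideanSpace ℝ ι} (hu : IsSmoothL2Field u) (L : ℕ) :
    ∑ j ∈ Finset.Icc (-(L : ℤ)) L, (2 : ℝ) ^ (2 * j) * ∫ x, ‖blockFn j u x‖ ^ 2 =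
      (∑ j ∈ Finset.Icc (-(L : ℤ)) L, ((2 : ℝ≥0∞) ^ j * blockL2 u j) ^ 2).toReal := by
  have h2 : (2 : ℝ≥0∞) ≠ 0 := two_ne_zero
  have h2' : (2 : ℝ≥0∞) ≠ ∞ := ENNReal.ofNat_ne_top
  have hfin : ∀ j, blockL2 u j ^ 2 ≠ ∞ := fun j => ENNReal.pow_ne_top ((hu.blockFn j).memLp_two).eLpNorm_ne_top
  have hterm : ∀ j, ((2 : ℝ≥0∞) ^ j * blockL2 u j) ^ 2 = (2 : ℝ≥0∞) ^ (2 * j) * blockL2 u j ^ 2 := fun j => by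
    rw [mul_pow, two_mul, ENNReal.zpow_add h2 h2', sq]
  simp_rw [hterm]
  rw [ENNReal.toReal_sum fun j _ => ENNReal.mul_ne_top (two_zpow_ne_top _) (hfin j)]
  refine Finset.sum_congr rfl fun j _ => ?_
  rw [ENNReal.toReal_mul, toReal_two_zpow, blockL2, integral_norm_sq_eq_toReal_eLpNorm_sq (hu.blockFn j).memLp_two.1]

omit [Nonempty ι] in
/-- Symmetric partial sums converge to the `ℤ`-indexed sum in `ℝ≥0∞`. [folklore] -/
theorem tendsto_sum_Icc_atTop (f : ℤ → ℝ≥0∞) :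
    Tendsto (fun L : ℕ => ∑ l ∈ Finset.Icc (-(L : ℤ)) L, f l) atTop (𝓝 (∑' l, f l)) := by
  have h := (ENNReal.summable (f := f)).hasSum
  refine h.comp (tendsto_atTop_finset_of_monotone (fun a b hab => ?_) fun x => ⟨x.natAbs, ?_⟩)
  · exact Finset.Icc_subset_Icc (by omega) (by omega)
  · simp only [Finset.mem_Icc]; omega

omit [Nonempty ι] in
/-- The dyadic energy is finite on a slab with bounded gradients: `F(v(τ)) ≤ 8 d C_r² S₁`. [folklore] -/
theorem dyadicF_le_of_gradSq_le {u : EuclideanSpace ℝ ι → EuclideanSpace ℝ ι} (hu : IsSmoothL2Field u) {S₁ : ℝ≥0}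
    (hS₁ : gradSq u ≤ S₁) : dyadicF u ≤ 8 * (Fintype.card ι * ((K.Cr : ℝ≥0∞) ^ 2 * S₁)) :=
  (K.dyadicF_le_gradSq hu).trans (by gcongr)

/-- **The two-point inequality for the dyadic energy along a smooth slab solution** (the integrated
form of Cheskidov–Shvydkoy's Gronwall inequality, arXiv:0708.3067 p. 6, in the `H¹` version): with
`f(τ) = F(v(τ)).toReal` and the constants `K_c, G_c` of this file, for `t₁ ≤ s ≤ t ≤ t₂`,
`f(t) ≤ f(s) + (t - s) (2 G_c + 2 K_c sup_{[s,t]} f)`. [folklore] -/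
theorem IsSmoothSlabSolution.dyadicF_two_point (h : IsSmoothSlabSolution t₁ t₂ ν v p) (hν : 0 ≤ ν)
    {J : ℤ} {κ E₀ S₁ S₃ ε₁ ε₂ : ℝ≥0}
    (hs : ∀ τ ∈ Icc t₁ t₂, ∀ l, J ≤ l → blockSup (v τ) l ≤ κ * 2 ^ l)
    (hE : ∀ τ ∈ Icc t₁ t₂, eLpNorm (v τ) 2 volume ≤ E₀) (hS₁ : ∀ τ ∈ Icc t₁ t₂, gradSq (v τ) ≤ S₁)
    (hS₃ : ∀ τ ∈ Icc t₁ t₂, thirdSum (v τ) ≤ S₃) (hε₁ : ε₁ ≠ 0) (hε₂ : ε₂ ≠ 0)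
    (hsmall : 2 * Fintype.card ι * K.cAlpha J κ E₀ ε₁ ε₂ ≤ ENNReal.ofReal ν)
    {s t : ℝ} (hs' : t₁ ≤ s) (hst : s ≤ t) (ht : t ≤ t₂) :
    (dyadicF (v t)).toReal ≤ (dyadicF (v s)).toReal + (t - s) * (2 * (K.cG J E₀ ε₂).toReal +
      2 * (K.cK J E₀ ε₁).toReal * sSup ((fun τ => (dyadicF (v τ)).toReal) '' Icc s t)) := by
  set f : ℝ → ℝ := fun τ => (dyadicF (v τ)).toReal with hf
  set Φ := sSup (f '' Icc s t) with hΦ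
  set Gc := K.cG J E₀ ε₂ with hGc
  set Kc := K.cK J E₀ ε₁ with hKc
  have hsub : Icc s t ⊆ Icc t₁ t₂ := Icc_subset_Icc hs' ht
  -- finiteness of `F` on the slab and the supremum
  set Fmax : ℝ≥0∞ := 8 * (Fintype.card ι * ((K.Cr : ℝ≥0∞) ^ 2 * S₁)) with hFmax
  have hFmax_top : Fmax ≠ ∞ := ENNReal.mul_ne_top (by norm_num) (ENNReal.mul_ne_top (ENNReal.natCast_ne_top _)
    (ENNReal.mul_ne_top (ENNReal.pow_ne_top ENNReal.coe_ne_top) ENNReal.coe_ne_top))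
  have hFle : ∀ τ ∈ Icc t₁ t₂, dyadicF (v τ) ≤ Fmax := fun τ hτ =>
    dyadicF_le_of_gradSq_le K (h.smooth_slice τ hτ) (hS₁ τ hτ)
  have hFtop : ∀ τ ∈ Icc t₁ t₂, dyadicF (v τ) ≠ ∞ := fun τ hτ => ne_top_of_le_ne_top hFmax_top (hFle τ hτ)
  have hfB : ∀ τ ∈ Icc t₁ t₂, f τ ≤ Fmax.toReal := fun τ hτ => ENNReal.toReal_mono hFmax_top (hFle τ hτ)
  have hbdd : BddAbove (f '' Icc s t) := ⟨Fmax.toReal, by rintro _ ⟨τ, hτ, rfl⟩; exact hfB τ (hsub hτ)⟩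
  have hfΦ : ∀ τ ∈ Icc s t, f τ ≤ Φ := fun τ hτ => le_csSup hbdd ⟨τ, hτ, rfl⟩
  have hΦ0 : 0 ≤ Φ := le_csSup_of_le hbdd ⟨s, ⟨le_rfl, hst⟩, rfl⟩ ENNReal.toReal_nonneg
  have hKc0 : 0 ≤ Kc.toReal := ENNReal.toReal_nonneg
  -- Step 1: the inequality at level `L`
  have hL : ∀ L : ℕ,
      (∑ j ∈ Finset.Icc (-(L : ℤ)) L, ((2 : ℝ≥0∞) ^ j * blockL2 (v t) j) ^ 2).toReal -
        (∑ j ∈ Finset.Icc (-(L : ℤ)) L, ((2 : ℝ≥0∞) ^ j * blockL2 (v s) j) ^ 2).toReal ≤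
      2 * ((t - s) * ((K.cAlpha J κ E₀ ε₁ ε₂ * ((4⁻¹ : ℝ≥0∞) ^ L * K.cTail E₀ S₃) + Gc).toReal + Kc.toReal * Φ)) := by
    intro L
    rw [← sum_Icc_energy_eq_toReal (h.smooth_slice t ⟨hs'.trans hst, ht⟩),
      ← sum_Icc_energy_eq_toReal (h.smooth_slice s ⟨hs', hst.trans ht⟩), h.weighted_blockEnergy_eq L hs' hst ht]
    gcongr
    -- integrate the pointwise bound
    have hint : IntervalIntegrable (fun τ => ∑ j ∈ Finset.Icc (-(L : ℤ)) L, (2 : ℝ) ^ (2 * j) *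
        (-ν * (∑ i, ∫ x, ‖fderiv ℝ (blockFn j (v τ)) x (stdOrthonormalBasis ℝ (EuclideanSpace ℝ ι) i)‖ ^ 2) -
          ∫ x, ⟪blockFn j (v τ) x, blockFn j (convect (v τ) (v τ)) x⟫)) volume s t :=
      (IntervalIntegrable.sum (Finset.Icc (-(L : ℤ)) L) fun j _ =>
        (h.intervalIntegrable_rhs j hs' hst ht).const_mul ((2 : ℝ) ^ (2 * j))).congr fun τ _ => by
          simp only [Finset.sum_apply]
    calc ∫ τ in s..t, ∑ j ∈ Finset.Icc (-(L : ℤ)) L, (2 : ℝ) ^ (2 * j) *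
          (-ν * (∑ i, ∫ x, ‖fderiv ℝ (blockFn j (v τ)) x (stdOrthonormalBasis ℝ (EuclideanSpace ℝ ι) i)‖ ^ 2) -
            ∫ x, ⟪blockFn j (v τ) x, blockFn j (convect (v τ) (v τ)) x⟫)
        ≤ ∫ _ in s..t, ((K.cAlpha J κ E₀ ε₁ ε₂ * ((4⁻¹ : ℝ≥0∞) ^ L * K.cTail E₀ S₃) + Gc).toReal + Kc.toReal * Φ) := by
          refine intervalIntegral.integral_mono_on hst hint intervalIntegrable_const fun τ hτ => ?_
          have hτ' := hsub hτ
          refine (weighted_integrand_le K (h.smooth_slice τ hτ') (h.ns.divFree τ hτ') hν (hs τ hτ') (hE τ hτ')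
            (hS₃ τ hτ') hε₁ hε₂ hsmall (hFtop τ hτ') L).trans ?_
          exact add_le_add_right (mul_le_mul_of_nonneg_left (hfΦ τ hτ) hKc0) _
      _ = (t - s) * (((K.cAlpha J κ E₀ ε₁ ε₂ * ((4⁻¹ : ℝ≥0∞) ^ L * K.cTail E₀ S₃) + Gc).toReal + Kc.toReal * Φ)) := by
          rw [intervalIntegral.integral_const, smul_eq_mul]
  -- Step 2: `L → ∞`
  have hlimF : ∀ τ ∈ Icc t₁ t₂, Tendsto (fun L : ℕ => (∑ j ∈ Finset.Icc (-(L : ℤ)) L,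
      ((2 : ℝ≥0∞) ^ j * blockL2 (v τ) j) ^ 2).toReal) atTop (𝓝 (f τ)) := fun τ hτ =>
    (ENNReal.tendsto_toReal (hFtop τ hτ)).comp (tendsto_sum_Icc_atTop _)
  have hlimC : Tendsto (fun L : ℕ => ((K.cAlpha J κ E₀ ε₁ ε₂ * ((4⁻¹ : ℝ≥0∞) ^ L * K.cTail E₀ S₃) + Gc).toReal))
      atTop (𝓝 Gc.toReal) := by
    have hGtop : Gc ≠ ∞ := K.cG_ne_top J E₀ hε₂
    have h0 : Tendsto (fun L : ℕ => K.cAlpha J κ E₀ ε₁ ε₂ * ((4⁻¹ : ℝ≥0∞) ^ L * K.cTail E₀ S₃)) atTop (𝓝 0) := by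
      have h4 : Tendsto (fun L : ℕ => (4⁻¹ : ℝ≥0∞) ^ L) atTop (𝓝 0) :=
        ENNReal.tendsto_pow_atTop_nhds_zero_of_lt_one (by norm_num)
      have h5 : Tendsto (fun L : ℕ => (4⁻¹ : ℝ≥0∞) ^ L * K.cTail E₀ S₃) atTop (𝓝 (0 * K.cTail E₀ S₃)) :=
        ENNReal.Tendsto.mul_const h4 (Or.inr (K.cTail_ne_top E₀ S₃))
      rw [zero_mul] at h5
      have h6 := ENNReal.Tendsto.const_mul h5 (Or.inr (K.cAlpha_ne_top J κ E₀ ε₁ ε₂))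
      rwa [mul_zero] at h6
    have h1 : Tendsto (fun L : ℕ => K.cAlpha J κ E₀ ε₁ ε₂ * ((4⁻¹ : ℝ≥0∞) ^ L * K.cTail E₀ S₃) + Gc) atTop (𝓝 (0 + Gc)) :=
      h0.add tendsto_const_nhds
    rw [zero_add] at h1
    exact (ENNReal.tendsto_toReal hGtop).comp h1
  have hlim := le_of_tendsto_of_tendsto ((hlimF t ⟨hs'.trans hst, ht⟩).sub (hlimF s ⟨hs', hst.trans ht⟩))
    ((hlimC.add tendsto_const_nhds).const_mul (t - s) |>.const_mul 2) (Eventually.of_forall hL)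
  rw [hf] at hlim
  simp only at hlim
  linarith [hlim]

/-- **The `H¹`-level a-priori estimate along a smooth slab solution, dyadic form** (the Gronwall
conclusion of Cheskidov–Shvydkoy's Lemma 3.2 in the `H¹` version): under the smallness of the high
blocks in `B^{-1}_{∞,∞}` (`‖Δ̇_l v(τ)‖_∞ ≤ κ 2^l`, `l ≥ J`, with `2 d α ≤ ν`),
`F(v(t)) ≤ (F(v(t₁)) + 2 G_c (t - t₁)) · exp(4 K_c (t - t₁))` for `t ∈ [t₁, t₂]`, with constants
depending only on `ν, J, κ, E₀, ε₁, ε₂` and the Littlewood–Paley constants — not on the `H¹` norm.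
[cite: CheskidovShvydkoy2010, Lemma 3.2] -/
theorem IsSmoothSlabSolution.dyadicF_le_exp (h : IsSmoothSlabSolution t₁ t₂ ν v p) (hν : 0 ≤ ν)
    {J : ℤ} {κ E₀ S₁ S₃ ε₁ ε₂ : ℝ≥0}
    (hs : ∀ τ ∈ Icc t₁ t₂, ∀ l, J ≤ l → blockSup (v τ) l ≤ κ * 2 ^ l)
    (hE : ∀ τ ∈ Icc t₁ t₂, eLpNorm (v τ) 2 volume ≤ E₀) (hS₁ : ∀ τ ∈ Icc t₁ t₂, gradSq (v τ) ≤ S₁)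
    (hS₃ : ∀ τ ∈ Icc t₁ t₂, thirdSum (v τ) ≤ S₃) (hε₁ : ε₁ ≠ 0) (hε₂ : ε₂ ≠ 0)
    (hsmall : 2 * Fintype.card ι * K.cAlpha J κ E₀ ε₁ ε₂ ≤ ENNReal.ofReal ν)
    {t : ℝ} (ht : t ∈ Icc t₁ t₂) :
    (dyadicF (v t)).toReal ≤ ((dyadicF (v t₁)).toReal + 2 * (K.cG J E₀ ε₂).toReal * (t - t₁)) *
      Real.exp (2 * (2 * (K.cK J E₀ ε₁).toReal) * (t - t₁)) := by
  set f : ℝ → ℝ := fun τ => (dyadicF (v τ)).toReal with hf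
  set Fmax : ℝ≥0∞ := 8 * (Fintype.card ι * ((K.Cr : ℝ≥0∞) ^ 2 * S₁)) with hFmax
  have hFmax_top : Fmax ≠ ∞ := ENNReal.mul_ne_top (by norm_num) (ENNReal.mul_ne_top (ENNReal.natCast_ne_top _)
    (ENNReal.mul_ne_top (ENNReal.pow_ne_top ENNReal.coe_ne_top) ENNReal.coe_ne_top))
  have hfB : ∀ τ ∈ Icc t₁ t, f τ ≤ Fmax.toReal := fun τ hτ =>
    ENNReal.toReal_mono hFmax_top (dyadicF_le_of_gradSq_le K (h.smooth_slice τ ⟨hτ.1, hτ.2.trans ht.2⟩)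
      (hS₁ τ ⟨hτ.1, hτ.2.trans ht.2⟩))
  have key := le_mul_exp_of_two_point_sup (f := f) (a := t₁) (b := t) (G := 2 * (K.cG J E₀ ε₂).toReal)
    (K := 2 * (K.cK J E₀ ε₁).toReal) (B := Fmax.toReal) ht.1 (by positivity) (by positivity) hfB
    (fun τ _ => ENNReal.toReal_nonneg) fun s hs'' τ hτ =>
      h.dyadicF_two_point K hν hs hE hS₁ hS₃ hε₁ hε₂ hsmall hs''.1 hτ.1 (hτ.2.trans ht.2)
  simpa [hf, mul_comm] using key

/-- **The `H¹` a-priori estimate along a smooth slab solution** (Cheskidov–Shvydkoy 2010, Lemma 3.2,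
`H¹` version, conditional form): under the hypotheses of `dyadicF_le_exp`,
`∑_i ‖∂_i v(t)‖²₂ ≤ 2 d C_b² (8 d C_r² ∑_i ‖∂_i v(t₁)‖²₂ + 2 G_c (t - t₁)) exp(4 K_c (t - t₁))`
for `t ∈ [t₁, t₂]` — a bound on the enstrophy with constants independent of the enstrophy, which is
what continues the regular solution past `t₂` (Leray's `H¹` continuation criterion).
[cite: CheskidovShvydkoy2010, Lemma 3.2] -/
theorem IsSmoothSlabSolution.gradSq_le_exp (h : IsSmoothSlabSolution t₁ t₂ ν v p) (hν : 0 ≤ ν)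
    {J : ℤ} {κ E₀ S₁ S₃ ε₁ ε₂ : ℝ≥0}
    (hs : ∀ τ ∈ Icc t₁ t₂, ∀ l, J ≤ l → blockSup (v τ) l ≤ κ * 2 ^ l)
    (hE : ∀ τ ∈ Icc t₁ t₂, eLpNorm (v τ) 2 volume ≤ E₀) (hS₁ : ∀ τ ∈ Icc t₁ t₂, gradSq (v τ) ≤ S₁)
    (hS₃ : ∀ τ ∈ Icc t₁ t₂, thirdSum (v τ) ≤ S₃) (hε₁ : ε₁ ≠ 0) (hε₂ : ε₂ ≠ 0)
    (hsmall : 2 * Fintype.card ι * K.cAlpha J κ E₀ ε₁ ε₂ ≤ ENNReal.ofReal ν)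
    {t : ℝ} (ht : t ∈ Icc t₁ t₂) :
    (gradSq (v t)).toReal ≤ 2 * ((K.Cb : ℝ) ^ 2 * Fintype.card ι) *
      (((8 * (Fintype.card ι * ((K.Cr : ℝ) ^ 2 * (gradSq (v t₁)).toReal))) +
        2 * (K.cG J E₀ ε₂).toReal * (t - t₁)) * Real.exp (2 * (2 * (K.cK J E₀ ε₁).toReal) * (t - t₁))) := by
  have h1 := h.dyadicF_le_exp K hν hs hE hS₁ hS₃ hε₁ hε₂ hsmall ht
  -- `gradSq ≤ 2 C_b² d F` at time `t`
  have hFt : dyadicF (v t) ≠ ∞ := ne_top_of_le_ne_top (ENNReal.mul_ne_top (by norm_num)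
      (ENNReal.mul_ne_top (ENNReal.natCast_ne_top _) (ENNReal.mul_ne_top (ENNReal.pow_ne_top ENNReal.coe_ne_top)
        ENNReal.coe_ne_top))) (dyadicF_le_of_gradSq_le K (h.smooth_slice t ht) (hS₁ t ht))
  have h2 : (gradSq (v t)).toReal ≤ 2 * ((K.Cb : ℝ) ^ 2 * Fintype.card ι) * (dyadicF (v t)).toReal := by
    have := ENNReal.toReal_mono (ENNReal.mul_ne_top (by norm_num) (ENNReal.mul_ne_top
      (ENNReal.pow_ne_top ENNReal.coe_ne_top) (ENNReal.mul_ne_top (ENNReal.natCast_ne_top _) hFt)))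
      (K.gradSq_le_dyadicF (h.smooth_slice t ht))
    rw [ENNReal.toReal_mul, ENNReal.toReal_mul, ENNReal.toReal_mul, ENNReal.toReal_pow] at this
    simpa [mul_assoc] using this
  -- `F ≤ 8 d C_r² gradSq` at time `t₁`
  have hG1 : gradSq (v t₁) ≠ ∞ := ne_top_of_le_ne_top ENNReal.coe_ne_top (hS₁ t₁ ⟨le_rfl, ht.1.trans ht.2⟩)
  have h3 : (dyadicF (v t₁)).toReal ≤ 8 * (Fintype.card ι * ((K.Cr : ℝ) ^ 2 * (gradSq (v t₁)).toReal)) := by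
    have := ENNReal.toReal_mono (ENNReal.mul_ne_top (by norm_num) (ENNReal.mul_ne_top (ENNReal.natCast_ne_top _)
      (ENNReal.mul_ne_top (ENNReal.pow_ne_top ENNReal.coe_ne_top) hG1)))
      (K.dyadicF_le_gradSq (h.smooth_slice t₁ ⟨le_rfl, ht.1.trans ht.2⟩))
    rw [ENNReal.toReal_mul, ENNReal.toReal_mul, ENNReal.toReal_mul, ENNReal.toReal_pow] at this
    simpa using this
  refine h2.trans (mul_le_mul_of_nonneg_left (h1.trans ?_) (by positivity))
  gcongr

end Slab

end Literature.Analysis.FluidPDE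

end
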